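import Literature.NumberTheory.EllipticCurves.Rank1Residual.Typed.SelmerCardUpperBoundCertificate
import Summits.BirchSwinnertonDyer.Rank1Residual.X11b.ChaPairsMinimality
import HarnessLib

/-!
# LW16 re-route, record SHAPES: `BSD(E,p)` on a literal Cremona model from ONE descent certificate line
# (Ш-currency or Selmer-currency), no Lawson–Wuthrich / Heegner / torsion / image binder

HONEST FRAMING (programme BSD-LIT2PART v1 §T3, cell `pub/bsd-litref/lw16`, seat `bsd-litref-lw16-pv`
«consumer re-route to the undisputed form»; CONSUMERS.md sha16 c75348a6c4f5f01c): the register's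
14 493 cells `(class, p)` with REDUCIBLE `E[p]` closed by the lane row T-LW rest on Lawson–Wuthrich
2016 Thm. 14 in the certificate case `p ∤ [E(K):ℤy_K] ⇒ Ш(E/ℚ)[p] = 0` — GJPST 2009 Thm. 3.7 verbatim,
called "unproved" by Matar–Nekovář 2019 §0.10 and "unjustified" (§0.11) at reducible `ρ̄_{E,p}`; flag
`LW16-Thm14-disputed-MN19-0.11`. Matar–Nekovář's own theorems (0.3, 0.12) require `E[p]` irreducible,
so no Kolyvagin-type statement is undisputed in print at these pairs. The undisputed road is a
per-curve `p`-descent (Miller–Stoll 2013 §§6–7 / Thm. 9.1 — the road Lawson–Wuthrich §5 itself takes;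
Schaefer–Stoll), whose kernel consumers are class-free: `Typed.bsdp_of_shaAn_unit_of_noPTorsion`
(Ш-currency) and `Typed.bsdp_of_card_selmerGroup_le_pow_analyticRank` (Selmer-currency, p457798).
This file only fixes the SHAPE of the per-pair record theorems on a LITERAL integer model
`⟨a₁,a₂,a₃,a₄,a₆⟩` (Cremona's curve 1 of the class = the lane's curve): ellipticity is DECIDED by the
kernel (`discOf ≠ 0`, `X11b.isElliptic_of_discOf_ne_zero`); what REMAINS displayed is the PUBLISHED
named fact `hGZK` (Gross–Zagier–Kolyvagin, bsd.S17), the per-pair data `hr` (analytic rank, Cremona =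
the lane's record), `hq`/`hv` (`#Ш_an = q`, `ord_p q = 0` — the lane's two-engine Gross–Zagier value of
the T-LW record, unchanged), and ONE certificate line — `hSha : Ш(E/ℚ)[p] = 0` (evidence: a two-method
`p`-isogeny descent row with EXCESS `= 0`, sha-2's `isogchi.gp` + `isogcft.gp` as run by cc-eng-2's
instrument B-3, or a full `p`-descent) or `hle : #Sel^(p)(E/ℚ) ≤ p ^ r` (evidence: a full `p`-descent in
EXACT mode, or `dim Sel^φ + dim Sel^φ̂ = r` from the isogeny descent when no curve of the class has a
rational `p`-torsion point — the T-LW torsion clause). Nothing here is new mathematics; this is not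
"finishing BSD"; per pair, never a class theorem; NOTHING is booked by this file (the desk books).
Theorems only (no definition, no named fact, no `sorry`).

References: [Miller2011LMS] §1, Def. 1.1; [MillerStoll2013] §§6–7, Thm. 9.1; [SilvermanAEC2009]
Thm. X.4.2; [LawsonWuthrich2016] §5 (arXiv:1505.02940 p. 9); [MatarNekovar2019] §0.10–0.11 (p. 457);
[Cremona1997] Table 1 (`allcurves`, `allbsd`).
-/

noncomputable section

open scoped Classical

open WeierstrassCurve Literature.NumberTheory.EllipticCurves
  Literature.NumberTheory.EllipticCurves.Rank1Residual.Typed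
  Literature.NumberTheory.EllipticCurves.Rank1Residual.X11RankOneCertificates
  Summit.BirchSwinnertonDyer.Rank1Residual.X11b

namespace Summit.BirchSwinnertonDyer.Rank1Residual.LW16

/-! ### Ш-currency: the certificate line is `Ш(E/ℚ)[p] = 0` -/

/-- **Record shape (Ш-currency), analytic rank `≤ 1`.** On the literal model `[a₁,a₂,a₃,a₄,a₆]` with
`Δ ≠ 0` (kernel-decided), `BSD(E,p)` from: GZK (`hGZK`), `r_an ≤ 1` (`hr`), `#Ш_an = q` with `ord_p q = 0`
(`hq`, `hv`), and the certificate `Ш(E/ℚ)[p] = 0` (`hSha`). The composition is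
`Typed.bsdp_of_shaAn_unit_of_noPTorsion` (Miller's Def. 1.1, both valuations `0`). No image,
reduction-type, Heegner or torsion binder. [cite: Miller2011LMS, §1 and Def. 1.1]
[cite: MillerStoll2013, Thm. 9.1 ("If the ℓ-primary parts of Ш … are predicted … to be trivial, then they are indeed trivial, and so BSD(E, ℓ) holds")] -/
theorem bsdp_of_ainvs_of_noPTorsionSha (hGZK : rank_eq_analyticRank_of_analyticRank_le_one)
    (a1 a2 a3 a4 a6 : ℤ) (p : ℕ) [Fact p.Prime] (hΔ : discOf [a1, a2, a3, a4, a6] ≠ 0)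
    (hr : (⟨a1, a2, a3, a4, a6⟩ : WeierstrassCurve ℚ).analyticRank ≤ 1) {q : ℚ}
    (hq : shaAn (⟨a1, a2, a3, a4, a6⟩ : WeierstrassCurve ℚ) = (q : ℂ)) (hv : padicValRat p q = 0)
    (hSha : ∀ x : (⟨a1, a2, a3, a4, a6⟩ : WeierstrassCurve ℚ).sha, (p : ℤ) • x = 0 → x = 0) :
    BSDp (⟨a1, a2, a3, a4, a6⟩ : WeierstrassCurve ℚ) p := by
  haveI := isElliptic_of_discOf_ne_zero a1 a2 a3 a4 a6 hΔ
  exact bsdp_of_shaAn_unit_of_noPTorsion _ p hGZK hr hq hv hSha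

/-- **Record shape (Ш-currency), analytic rank `0`** (the 1 551 rank-zero cells of the flag, all
additive at `p`): as `bsdp_of_ainvs_of_noPTorsionSha` with `hr : r_an = 0` displayed as in the lane's
record. [cite: Miller2011LMS, §1 and Def. 1.1] -/
theorem bsdp_rankZero_of_ainvs_of_noPTorsionSha (hGZK : rank_eq_analyticRank_of_analyticRank_le_one)
    (a1 a2 a3 a4 a6 : ℤ) (p : ℕ) [Fact p.Prime] (hΔ : discOf [a1, a2, a3, a4, a6] ≠ 0)
    (hr : (⟨a1, a2, a3, a4, a6⟩ : WeierstrassCurve ℚ).analyticRank = 0) {q : ℚ}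
    (hq : shaAn (⟨a1, a2, a3, a4, a6⟩ : WeierstrassCurve ℚ) = (q : ℂ)) (hv : padicValRat p q = 0)
    (hSha : ∀ x : (⟨a1, a2, a3, a4, a6⟩ : WeierstrassCurve ℚ).sha, (p : ℤ) • x = 0 → x = 0) :
    BSDp (⟨a1, a2, a3, a4, a6⟩ : WeierstrassCurve ℚ) p :=
  bsdp_of_ainvs_of_noPTorsionSha hGZK a1 a2 a3 a4 a6 p hΔ (by omega) hq hv hSha

/-- **Record shape (Ш-currency), analytic rank `1`** (the 12 942 rank-one cells of the flag): as
`bsdp_of_ainvs_of_noPTorsionSha` with `hr : r_an = 1` displayed. [cite: Miller2011LMS, §1 and Def. 1.1] -/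
theorem bsdp_rankOne_of_ainvs_of_noPTorsionSha (hGZK : rank_eq_analyticRank_of_analyticRank_le_one)
    (a1 a2 a3 a4 a6 : ℤ) (p : ℕ) [Fact p.Prime] (hΔ : discOf [a1, a2, a3, a4, a6] ≠ 0)
    (hr : (⟨a1, a2, a3, a4, a6⟩ : WeierstrassCurve ℚ).analyticRank = 1) {q : ℚ}
    (hq : shaAn (⟨a1, a2, a3, a4, a6⟩ : WeierstrassCurve ℚ) = (q : ℂ)) (hv : padicValRat p q = 0)
    (hSha : ∀ x : (⟨a1, a2, a3, a4, a6⟩ : WeierstrassCurve ℚ).sha, (p : ℤ) • x = 0 → x = 0) :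
    BSDp (⟨a1, a2, a3, a4, a6⟩ : WeierstrassCurve ℚ) p :=
  bsdp_of_ainvs_of_noPTorsionSha hGZK a1 a2 a3 a4 a6 p hΔ (by omega) hq hv hSha

/-! ### Selmer-currency: the certificate line is `#Sel^(p)(E/ℚ) ≤ p ^ r` -/

/-- **Record shape (Selmer-currency), analytic rank `≤ 1`.** On the literal model with `Δ ≠ 0`,
`BSD(E,p)` from GZK, `r_an ≤ 1`, `#Ш_an = q` with `ord_p q = 0`, and the UPPER-BOUND certificate
`#Sel^(p)(E/ℚ) ≤ p ^ r_an` (`hle`; exact by `Typed.natCard_selmerGroup_eq_pow_rank_of_le`). Composition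
= `Typed.bsdp_of_card_selmerGroup_le_pow_analyticRank`. [cite: SilvermanAEC2009, Thm X.4.2(a),(b)]
[cite: Miller2011LMS, §1 and Def. 1.1] [cite: MillerStoll2013, Lemma 6.3 and Cor. 7.3] -/
theorem bsdp_of_ainvs_of_card_selmerGroup_le (hGZK : rank_eq_analyticRank_of_analyticRank_le_one)
    (a1 a2 a3 a4 a6 : ℤ) (p : ℕ) [Fact p.Prime] (hΔ : discOf [a1, a2, a3, a4, a6] ≠ 0)
    (hr : (⟨a1, a2, a3, a4, a6⟩ : WeierstrassCurve ℚ).analyticRank ≤ 1) {q : ℚ}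
    (hq : shaAn (⟨a1, a2, a3, a4, a6⟩ : WeierstrassCurve ℚ) = (q : ℂ)) (hv : padicValRat p q = 0)
    (hle : Nat.card ((⟨a1, a2, a3, a4, a6⟩ : WeierstrassCurve ℚ).selmerGroup (p : ℤ)) ≤
      p ^ (⟨a1, a2, a3, a4, a6⟩ : WeierstrassCurve ℚ).analyticRank) :
    BSDp (⟨a1, a2, a3, a4, a6⟩ : WeierstrassCurve ℚ) p := by
  haveI := isElliptic_of_discOf_ne_zero a1 a2 a3 a4 a6 hΔ
  exact bsdp_of_card_selmerGroup_le_pow_analyticRank _ p hGZK hr hq hv hle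

/-- **Record shape (Selmer-currency), analytic rank `0`**: certificate `#Sel^(p)(E/ℚ) ≤ 1`, i.e.
`Sel^(p)(E/ℚ) = 0` (an isogeny descent with `dim Sel^φ = dim Sel^φ̂ = 0`, or a full `p`-descent).
[cite: SilvermanAEC2009, Thm X.4.2(a),(b)] [cite: Miller2011LMS, §1 and Def. 1.1] -/
theorem bsdp_rankZero_of_ainvs_of_card_selmerGroup_le_one
    (hGZK : rank_eq_analyticRank_of_analyticRank_le_one)
    (a1 a2 a3 a4 a6 : ℤ) (p : ℕ) [Fact p.Prime] (hΔ : discOf [a1, a2, a3, a4, a6] ≠ 0)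
    (hr : (⟨a1, a2, a3, a4, a6⟩ : WeierstrassCurve ℚ).analyticRank = 0) {q : ℚ}
    (hq : shaAn (⟨a1, a2, a3, a4, a6⟩ : WeierstrassCurve ℚ) = (q : ℂ)) (hv : padicValRat p q = 0)
    (hle : Nat.card ((⟨a1, a2, a3, a4, a6⟩ : WeierstrassCurve ℚ).selmerGroup (p : ℤ)) ≤ 1) :
    BSDp (⟨a1, a2, a3, a4, a6⟩ : WeierstrassCurve ℚ) p :=
  bsdp_of_ainvs_of_card_selmerGroup_le hGZK a1 a2 a3 a4 a6 p hΔ (by omega) hq hv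
    (by rw [hr, pow_zero]; exact hle)

/-- **Record shape (Selmer-currency), analytic rank `1`**: certificate `#Sel^(p)(E/ℚ) ≤ p`, i.e.
`dim_𝔽_p Sel^(p)(E/ℚ) ≤ 1` (an isogeny descent with `dim Sel^φ + dim Sel^φ̂ = 1` and no rational
`p`-torsion in the class, or a full `p`-descent in EXACT mode).
[cite: SilvermanAEC2009, Thm X.4.2(a),(b)] [cite: Miller2011LMS, §1 and Def. 1.1]
[cite: MillerStoll2013, Cor. 7.3] -/
theorem bsdp_rankOne_of_ainvs_of_card_selmerGroup_le_prime
    (hGZK : rank_eq_analyticRank_of_analyticRank_le_one)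
    (a1 a2 a3 a4 a6 : ℤ) (p : ℕ) [Fact p.Prime] (hΔ : discOf [a1, a2, a3, a4, a6] ≠ 0)
    (hr : (⟨a1, a2, a3, a4, a6⟩ : WeierstrassCurve ℚ).analyticRank = 1) {q : ℚ}
    (hq : shaAn (⟨a1, a2, a3, a4, a6⟩ : WeierstrassCurve ℚ) = (q : ℂ)) (hv : padicValRat p q = 0)
    (hle : Nat.card ((⟨a1, a2, a3, a4, a6⟩ : WeierstrassCurve ℚ).selmerGroup (p : ℤ)) ≤ p) :
    BSDp (⟨a1, a2, a3, a4, a6⟩ : WeierstrassCurve ℚ) p :=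
  bsdp_of_ainvs_of_card_selmerGroup_le hGZK a1 a2 a3 a4 a6 p hΔ (by omega) hq hv
    (by rw [hr, pow_one]; exact hle)

end Summit.BirchSwinnertonDyer.Rank1Residual.LW16

end
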